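import Literature.MathematicalPhysics.QuantumManyBody.BoseEinsteinCondensation
import Mathlib.MeasureTheory.Function.LpSeminorm.TriangleInequality
import Mathlib.Analysis.SpecialFunctions.Pow.Continuity
import Mathlib.Analysis.Calculus.FDeriv.Mul
import HarnessLib

/-!
# The ground state of the Dirichlet `N`-boson problem in a box (variational form)

Topic `Literature/MathematicalPhysics/QuantumManyBody` (definition item `defn-groundState`;
companion of `Literature.MathematicalPhysics.QuantumManyBody.BoseGas` in
`BoseEinsteinCondensation.lean`, whose `TrialState`, `energy`, `groundStateEnergy`,
`maxOccupation`, `condensateNumber` are referred to here; the one-particle objects of a state —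
density, density matrix, Palm laws, Hellinger affinity — are in `OneParticleMarginals.lean`).
Wanted by route `EqualScatteringTransfer` (crux `CondensateComparison`: the corrector
`g = Ψ₀ʷ/(D Ψ₀ᵛ)` between the ground states of two equal-scattering-length gases) and by the
Palm/affinity idea cards of `AtomisticToContinuum/BoseEinsteinCondensation`.

## Content

For a repulsive radial pair profile `v : ℝ → [0, ∞]` (hard cores `⊤` allowed), `N` bosons and the
box `Λ_L = (0, L)³` with Dirichlet conditions, `H_N = -∑ Δᵢ + ∑_{i<j} v(|xᵢ - xⱼ|)` (`ħ = 2m = 1`):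

* `TendstoL2 Φ Ψ` — the sequence of admissible trial states `Φ : ℕ → TrialState N L` converges
  to `Ψ : (ℝ³)^N → ℂ` in `L²((ℝ³)^N)`.
* `closedEnergy v L Ψ = inf { liminfₙ ⟨Φₙ, H_N Φₙ⟩ : Φₙ ∈ TrialState N L, Φₙ → Ψ in L² } ∈ [0, ∞]`
  — the lower-semicontinuous envelope (relaxation) of `energy v` from the symmetric `C¹`
  Dirichlet core. By Kato's description of the closure of a closable form (the closure is
  `lim t[uₙ]` along form-convergent sequences, Thm VI.1.17, and `uₙ → u` with `t[uₙ]` bounded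
  forces `u ∈ D(t̄)` with `t̄[u] ≤ liminf t[uₙ]`, Thm VI.1.16) this is the CLOSED Dirichlet
  quadratic form `q̄_{H_N}[Ψ]` of `H_N` at the normalised elements `Ψ` of the form domain (inside
  `H¹₀(Λ_L^N)_sym`), and `⊤` elsewhere — in particular off the unit sphere, trial states being
  normalised (`TendstoL2.lintegral_nnnorm_sq_eq_one`). Proved: `E₀ ≤ q̄` everywhere
  (`groundStateEnergy_le_closedEnergy`), `q̄ ≤ energy` on the core, so `inf q̄ = E₀ =
  groundStateEnergy v N L` (`iInf_closedEnergy_eq_groundStateEnergy`; Kato VI Cor. 1.19), and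
  invariance under a constant phase (`closedEnergy_const_mul_le`, via `TrialState.constMul`).
* `IsGroundState v L Ψ` — **`Ψ` is a ground state**: a Borel measurable, Dirichlet (zero off the
  open box), Bose-symmetric representative with `q̄[Ψ] = E₀(N, L) < ⊤`, i.e. a normalised
  MINIMISER of the closed form (normalisation is a consequence, `IsGroundState.norm_eq`). By the
  variational principle (Reed–Simon IV Thm XIII.2: `inf σ(H) = inf {q_H[ψ] : ψ ∈ Q(H), ‖ψ‖ = 1}`,
  attained exactly on `ker (H - inf σ(H))`) these are the normalised eigenvectors of the Dirichlet
  (Friedrichs) realisation of `H_N` at the bottom of its spectrum — Reed–Simon's "ground state"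
  (§XIII.12, p. 201) — in the Bose-symmetric sector, where `groundStateEnergy` lives (and where
  the absolute ground state lives when it is nondegenerate: §XIII.12, remark after Thm XIII.46).
  `IsGroundState.of_tendstoL2` (an `L²`-limit of trial states with `liminf` energy `≤ E₀` is a
  ground state) is the entry point for the existence proof; `IsGroundState.const_mul` (phases).
* `groundState v N L : (ℝ³)^N → ℝ` — **the** nonnegative ground state `Ψ₀ ≥ 0` (Perron–Frobenius
  choice of phase; LSSY Ch. 7: "the (nonnegative and normalized) ground state"), by classical
  choice among the nonnegative real functions whose complexification `IsGroundState`; **junk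
  value `0`** when there is none (`N = 0`, `L ≤ 0`, `E₀ = ⊤` for jammed hard cores, or no
  nonnegative minimiser). API: nonnegative, measurable, Dirichlet, symmetric in both branches;
  `isGroundState_groundState`, `lintegral_groundState_sq`.
* `HasUniqueGroundState v N L` — nondegeneracy as a HYPOTHESIS: a nonnegative ground state exists
  and any two ground states agree a.e. up to a constant phase; then every ground state is a.e. a
  phase times `groundState v N L` (`HasUniqueGroundState.exists_ae_eq_groundState`).

## Design choices / what is NOT here

* FACT-FREE: the module introduces no named (unproved) fact, so importing it adds nothing to a
  route's trust base. The classical theorems about `Ψ₀` are deliberately NOT asserted: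
  EXISTENCE for `N ≥ 1`, `L > 0`, measurable `v` with `E₀ < ⊤` (minimising sequences are bounded
  in `H¹₀(Λ_L^N)`; Rellich–Kondrachov on the bounded box gives an `L²`-convergent subsequence;
  lower semicontinuity; `|Ψ|`-smoothing for a nonnegative minimiser — Reed–Simon IV Thm XIII.64
  with §XIII.14–15), UNIQUENESS up to phase and strict positivity for `v` finite (positivity
  improving `e^{-tH}`, Reed–Simon IV Thms XIII.44–XIII.47; false in general for hard cores with a
  disconnected accessible region, Thm XIII.48(b)), and the identification
  `condensateNumber v N L = maxOccupation N Ψ₀` under `HasUniqueGroundState` (compactness of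
  near-minimisers + `L²`-continuity of `maxOccupation`) documented at `condensateNumber`. Routes
  needing them state them as items over this vocabulary. Mathlib has no closed quadratic forms,
  Friedrichs extension or `H¹₀` (searched `groundState`, `closable`, `Friedrichs`), whence the
  sequential definition of `q̄` over the existing `TrialState` core.
* Not imported: `GroundStateFeynmanKac.lean` (Brownian paths, and a named fact). For bounded `v`
  its `fkGroundState v N L` is expected to coincide with `groundState v N L`; not proved here.
* Representatives: `IsGroundState` asks for a Borel measurable, pointwise-Dirichlet,
  pointwise-symmetric representative (every `L²`-class of minimisers has one).
* `ℝ≥0∞` throughout; no `sInf`/`sSup` over `ℝ`.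

## References

* [ReedSimonIV1978] M. Reed, B. Simon, *Methods of Modern Mathematical Physics IV*, §XIII.1
  Thms XIII.1–XIII.2 (min-max, form version), §XIII.12 p. 201 (ground state := eigenvector at
  `inf σ(H)`; nondegeneracy Thms XIII.43–XIII.48; Bose systems, remark after Thm XIII.46),
  Thm XIII.64 (compact resolvent).
* [Kato1966] T. Kato, *Perturbation Theory for Linear Operators*, VI §1.3 Thm 1.16, §1.4
  Thm 1.17 and Cor. 1.19 (closure of a closable form; same lower bound).
* [LSSY2005] E. H. Lieb, R. Seiringer, J. P. Solovej, J. Yngvason, *The Mathematics of the Bose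
  Gas and its Condensation* (2005), §1.2 (1.16)–(1.19), Ch. 7 (the nonnegative normalised
  ground state `Ψ₀`).
-/

noncomputable section

open MeasureTheory Filter Metric
open scoped ENNReal NNReal ComplexConjugate Topology

namespace Literature.MathematicalPhysics.QuantumManyBody.BoseGas

/-! ### The closed energy form (lower-semicontinuous envelope from the `C¹` core) -/

/-- `Φₙ → Ψ` in `L²((ℝ³)^N)`: `∫ |Φₙ - Ψ|² → 0` along the sequence of admissible trial states `Φ`.
[folklore] -/
def TendstoL2 {N : ℕ} {L : ℝ} (Φ : ℕ → TrialState N L) (Ψ : Config N → ℂ) : Prop :=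
  Tendsto (fun n => ∫⁻ X, (‖(Φ n).ψ X - Ψ X‖₊ : ℝ≥0∞) ^ 2) atTop (𝓝 0)

/-- The **closed energy** `q̄_{H_N}[Ψ] ∈ [0, ∞]` of an `N`-body wave function `Ψ` in the box `Λ_L`:
the lower-semicontinuous envelope `inf { liminfₙ ⟨Φₙ, H_N Φₙ⟩ : Φₙ ∈ TrialState N L, Φₙ → Ψ in L² }`
of the energy from the symmetric `C¹` Dirichlet core, i.e. (Kato's construction of the closure of
a closable form, Thm 1.17, with Thm 1.16) the closed Dirichlet quadratic form of
`H_N = -∑Δᵢ + ∑_{i<j} v(|xᵢ-xⱼ|)` at `Ψ` when `Ψ` is a normalised element of the form domain, and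
`⊤` otherwise (in particular off the unit sphere of `L²`, trial states being normalised).
[cite: Kato1966, VI §1.4 Thm 1.17 and §1.3 Thm 1.16] -/
def closedEnergy {N : ℕ} (v : ℝ → ℝ≥0∞) (L : ℝ) (Ψ : Config N → ℂ) : ℝ≥0∞ :=
  ⨅ (Φ : ℕ → TrialState N L) (_ : TendstoL2 Φ Ψ), liminf (fun n => energy v (Φ n)) atTop

/-- The closed energy is bounded below by the `liminf` of the energies along any approximating
sequence of trial states (definition of the infimum). [cite: Kato1966, VI §1.3 Thm 1.16] -/
theorem closedEnergy_le_liminf {N : ℕ} (v : ℝ → ℝ≥0∞) {L : ℝ} {Φ : ℕ → TrialState N L}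
    {Ψ : Config N → ℂ} (h : TendstoL2 Φ Ψ) :
    closedEnergy v L Ψ ≤ liminf (fun n => energy v (Φ n)) atTop :=
  iInf₂_le (f := fun (Φ : ℕ → TrialState N L) (_ : TendstoL2 Φ Ψ) =>
    liminf (fun n => energy v (Φ n)) atTop) Φ h

/-- A trial state approximates itself: the constant sequence converges in `L²`. [folklore] -/
theorem tendstoL2_const {N : ℕ} {L : ℝ} (Φ : TrialState N L) : TendstoL2 (fun _ => Φ) Φ.ψ := by
  have : (fun _ : ℕ => ∫⁻ X, (‖Φ.ψ X - Φ.ψ X‖₊ : ℝ≥0∞) ^ 2) = fun _ => 0 := by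
    funext n
    simp
  rw [TendstoL2, this]
  exact tendsto_const_nhds

/-- On the core the closed energy is at most the energy: `q̄[Φ] ≤ ⟨Φ, H_N Φ⟩` (constant sequence;
in fact equality, the form being closable). [cite: Kato1966, VI §1.4 Thm 1.17] -/
theorem closedEnergy_le_energy {N : ℕ} (v : ℝ → ℝ≥0∞) {L : ℝ} (Φ : TrialState N L) :
    closedEnergy v L Φ.ψ ≤ energy v Φ := by
  refine (closedEnergy_le_liminf v (tendstoL2_const Φ)).trans_eq ?_
  exact liminf_const _

/-- **Variational principle for the closed form**: `E₀(N, L) ≤ q̄[Ψ]` for every `Ψ` (each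
approximating trial state has energy `≥ E₀`, so every `liminf` is `≥ E₀`).
[cite: ReedSimonIV1978, §XIII.1 Thm XIII.2] -/
theorem groundStateEnergy_le_closedEnergy {N : ℕ} (v : ℝ → ℝ≥0∞) (L : ℝ) (Ψ : Config N → ℂ) :
    groundStateEnergy v N L ≤ closedEnergy v L Ψ := by
  refine le_iInf₂ fun Φ _ => ?_
  exact le_liminf_of_le (h := Eventually.of_forall fun n => groundStateEnergy_le_energy v (Φ n))

/-- The closed form has the same infimum as the form on its core:
`inf_Φ q̄[Φ] = inf_Φ ⟨Φ, H_N Φ⟩ = E₀(N, L)` over admissible trial states.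
[cite: Kato1966, VI §1.4 Cor. 1.19] -/
theorem iInf_closedEnergy_eq_groundStateEnergy {N : ℕ} (v : ℝ → ℝ≥0∞) (L : ℝ) :
    ⨅ Φ : TrialState N L, closedEnergy v L Φ.ψ = groundStateEnergy v N L :=
  le_antisymm (iInf_mono fun Φ => closedEnergy_le_energy v Φ)
    (le_iInf fun Φ => groundStateEnergy_le_closedEnergy v L Φ.ψ)

/-- A function of finite closed energy is an `L²`-limit of trial states. [folklore] -/
theorem exists_tendstoL2_of_closedEnergy_ne_top {N : ℕ} {v : ℝ → ℝ≥0∞} {L : ℝ}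
    {Ψ : Config N → ℂ} (h : closedEnergy v L Ψ ≠ ⊤) :
    ∃ Φ : ℕ → TrialState N L, TendstoL2 Φ Ψ := by
  obtain ⟨Φ, hΦ⟩ := iInf_lt_iff.1 (lt_top_iff_ne_top.2 h)
  obtain ⟨hΦΨ, -⟩ := iInf_lt_iff.1 hΦ
  exact ⟨Φ, hΦΨ⟩

/-- The `L²` norm as the `eLpNorm` with exponent `2` (bookkeeping between `∫ |f|²` and Mathlib's
`eLpNorm f 2`). [folklore] -/
theorem eLpNorm_two_eq_rpow {N : ℕ} (f : Config N → ℂ) :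
    eLpNorm f 2 volume = (∫⁻ X, (‖f X‖₊ : ℝ≥0∞) ^ 2) ^ (1 / 2 : ℝ) := by
  rw [eLpNorm_eq_lintegral_rpow_enorm_toReal two_ne_zero ENNReal.ofNat_ne_top,
    ENNReal.toReal_ofNat]
  simp_rw [enorm_eq_nnnorm, ENNReal.rpow_two]

/-- **`L²`-limits of trial states are normalised**: if `Φₙ → Ψ` in `L²` with `‖Φₙ‖₂ = 1` and `Ψ`
a.e.-strongly measurable, then `∫ |Ψ|² = 1` (triangle inequality in `L²`). [folklore] -/
theorem TendstoL2.lintegral_nnnorm_sq_eq_one {N : ℕ} {L : ℝ} {Φ : ℕ → TrialState N L}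
    {Ψ : Config N → ℂ} (h : TendstoL2 Φ Ψ) (hΨ : AEStronglyMeasurable Ψ volume) :
    ∫⁻ X, (‖Ψ X‖₊ : ℝ≥0∞) ^ 2 = 1 := by
  have hΦm : ∀ n, AEStronglyMeasurable (Φ n).ψ volume := fun n =>
    (Φ n).contDiff.continuous.aestronglyMeasurable
  have hΦ1 : ∀ n, eLpNorm (Φ n).ψ 2 volume = 1 := fun n => by
    rw [eLpNorm_two_eq_rpow, (Φ n).norm_eq, ENNReal.one_rpow]
  -- the `L²` distance tends to `0`
  have hd : Tendsto (fun n => eLpNorm ((Φ n).ψ - Ψ) 2 volume) atTop (𝓝 0) := by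
    have h' : Tendsto (fun n => (∫⁻ X, (‖(Φ n).ψ X - Ψ X‖₊ : ℝ≥0∞) ^ 2) ^ (1 / 2 : ℝ)) atTop
        (𝓝 ((0 : ℝ≥0∞) ^ (1 / 2 : ℝ))) :=
      (ENNReal.continuous_rpow_const.tendsto 0).comp h
    rw [ENNReal.zero_rpow_of_pos (by norm_num)] at h'
    refine h'.congr fun n => ?_
    rw [eLpNorm_two_eq_rpow]
    rfl
  -- two triangle inequalities
  have hup : ∀ n, eLpNorm Ψ 2 volume ≤ 1 + eLpNorm ((Φ n).ψ - Ψ) 2 volume := by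
    intro n
    have e : (Φ n).ψ - ((Φ n).ψ - Ψ) = Ψ := sub_sub_cancel _ _
    have := eLpNorm_sub_le (hΦm n) ((hΦm n).sub hΨ) one_le_two (μ := volume)
    rwa [e, hΦ1 n] at this
  have hlow : ∀ n, 1 ≤ eLpNorm Ψ 2 volume + eLpNorm ((Φ n).ψ - Ψ) 2 volume := by
    intro n
    have e : Ψ + ((Φ n).ψ - Ψ) = (Φ n).ψ := by abel
    have := eLpNorm_add_le hΨ ((hΦm n).sub hΨ) one_le_two (μ := volume)
    rwa [e, hΦ1 n] at this
  have h2 : eLpNorm Ψ 2 volume = 1 := by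
    apply le_antisymm
    · have hl : Tendsto (fun n => 1 + eLpNorm ((Φ n).ψ - Ψ) 2 volume) atTop (𝓝 (1 + 0)) :=
        tendsto_const_nhds.add hd
      rw [add_zero] at hl
      exact ge_of_tendsto' hl hup
    · have hl : Tendsto (fun n => eLpNorm Ψ 2 volume + eLpNorm ((Φ n).ψ - Ψ) 2 volume) atTop
          (𝓝 (eLpNorm Ψ 2 volume + 0)) :=
        tendsto_const_nhds.add hd
      rw [add_zero] at hl
      exact ge_of_tendsto' hl hlow
  have h3 := congrArg (fun t : ℝ≥0∞ => t ^ (2 : ℝ)) h2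
  simp only [ENNReal.one_rpow] at h3
  rwa [eLpNorm_two_eq_rpow, ← ENNReal.rpow_mul, one_div, inv_mul_cancel₀ two_ne_zero,
    ENNReal.rpow_one] at h3

/-- A function of finite closed energy is normalised, `∫ |Ψ|² = 1` (trial states are, and the
closed energy is `⊤` off their `L²`-closure). [folklore] -/
theorem lintegral_nnnorm_sq_eq_one_of_closedEnergy_ne_top {N : ℕ} {v : ℝ → ℝ≥0∞} {L : ℝ}
    {Ψ : Config N → ℂ} (hΨ : AEStronglyMeasurable Ψ volume) (h : closedEnergy v L Ψ ≠ ⊤) :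
    ∫⁻ X, (‖Ψ X‖₊ : ℝ≥0∞) ^ 2 = 1 := by
  obtain ⟨Φ, hΦ⟩ := exists_tendstoL2_of_closedEnergy_ne_top h
  exact hΦ.lintegral_nnnorm_sq_eq_one hΨ

/-! ### Phase invariance -/

/-- A constant phase: `(‖c‖₊ : ℝ≥0∞) = 1` when `|c| = 1` (bookkeeping). [folklore] -/
theorem coe_nnnorm_eq_one_of_norm_eq_one {c : ℂ} (hc : ‖c‖ = 1) : (‖c‖₊ : ℝ≥0∞) = 1 := by
  have h1 : ‖c‖₊ = 1 := NNReal.eq (by simp [hc])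
  rw [h1, ENNReal.coe_one]

/-- Rotating a trial state by a constant phase `c`, `|c| = 1`: `Φ ↦ c Φ` (still `C¹`, Dirichlet,
symmetric and normalised). [folklore] -/
def TrialState.constMul {N : ℕ} {L : ℝ} (c : ℂ) (hc : ‖c‖ = 1) (Φ : TrialState N L) :
    TrialState N L where
  ψ X := c * Φ.ψ X
  contDiff := contDiff_const.mul Φ.contDiff
  eq_zero X hX := by simp [Φ.eq_zero X hX]
  symm σ X := by rw [Φ.symm σ X]
  norm_eq := by
    have : ∀ X, (‖c * Φ.ψ X‖₊ : ℝ≥0∞) ^ 2 = (‖Φ.ψ X‖₊ : ℝ≥0∞) ^ 2 := fun X => by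
      rw [nnnorm_mul, ENNReal.coe_mul, coe_nnnorm_eq_one_of_norm_eq_one hc, one_mul]
    simp_rw [this, Φ.norm_eq]

/-- The wave function of the rotated trial state is `c Φ`. [folklore] -/
@[simp] theorem TrialState.constMul_ψ {N : ℕ} {L : ℝ} (c : ℂ) (hc : ‖c‖ = 1)
    (Φ : TrialState N L) : (Φ.constMul c hc).ψ = fun X => c * Φ.ψ X := rfl

/-- The energy is invariant under a constant phase: `⟨cΦ, H_N cΦ⟩ = ⟨Φ, H_N Φ⟩`. [folklore] -/
theorem TrialState.energy_constMul {N : ℕ} {L : ℝ} (v : ℝ → ℝ≥0∞) (c : ℂ) (hc : ‖c‖ = 1)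
    (Φ : TrialState N L) : energy v (Φ.constMul c hc) = energy v Φ := by
  have hcn := coe_nnnorm_eq_one_of_norm_eq_one hc
  simp only [energy]
  refine lintegral_congr fun X => ?_
  have hk : kineticDensity (Φ.constMul c hc).ψ X = kineticDensity Φ.ψ X := by
    simp only [kineticDensity, TrialState.constMul_ψ]
    refine Finset.sum_congr rfl fun i _ => Finset.sum_congr rfl fun k _ => ?_
    have hd : fderiv ℝ (fun X => c * Φ.ψ X) X = c • fderiv ℝ Φ.ψ X :=
      (((Φ.contDiff.differentiable one_ne_zero) X).hasFDerivAt.const_mul c).fderiv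
    rw [hd]
    change (‖c • fderiv ℝ Φ.ψ X _‖₊ : ℝ≥0∞) ^ 2 = _
    rw [nnnorm_smul, ENNReal.coe_mul, hcn, one_mul]
  have hn : (‖(Φ.constMul c hc).ψ X‖₊ : ℝ≥0∞) ^ 2 = (‖Φ.ψ X‖₊ : ℝ≥0∞) ^ 2 := by
    simp only [TrialState.constMul_ψ]
    rw [nnnorm_mul, ENNReal.coe_mul, hcn, one_mul]
  rw [hk, hn]

/-- Rotated approximating sequences approximate the rotated limit. [folklore] -/
theorem TendstoL2.constMul {N : ℕ} {L : ℝ} {Φ : ℕ → TrialState N L} {Ψ : Config N → ℂ}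
    (h : TendstoL2 Φ Ψ) (c : ℂ) (hc : ‖c‖ = 1) :
    TendstoL2 (fun n => (Φ n).constMul c hc) (fun X => c * Ψ X) := by
  have : ∀ n, ∫⁻ X, (‖((Φ n).constMul c hc).ψ X - c * Ψ X‖₊ : ℝ≥0∞) ^ 2 =
      ∫⁻ X, (‖(Φ n).ψ X - Ψ X‖₊ : ℝ≥0∞) ^ 2 := fun n => by
    refine lintegral_congr fun X => ?_
    simp only [TrialState.constMul_ψ]
    rw [← mul_sub, nnnorm_mul, ENNReal.coe_mul, coe_nnnorm_eq_one_of_norm_eq_one hc, one_mul]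
  simp_rw [TendstoL2, this]
  exact h

/-- The closed energy does not increase under a constant phase (hence is invariant, applying the
statement to `c⁻¹`): `q̄[cΨ] ≤ q̄[Ψ]` for `|c| = 1`. [folklore] -/
theorem closedEnergy_const_mul_le {N : ℕ} (v : ℝ → ℝ≥0∞) {L : ℝ} (Ψ : Config N → ℂ) {c : ℂ}
    (hc : ‖c‖ = 1) : closedEnergy v L (fun X => c * Ψ X) ≤ closedEnergy v L Ψ := by
  show closedEnergy v L _ ≤
    ⨅ (Φ : ℕ → TrialState N L) (_ : TendstoL2 Φ Ψ), liminf (fun n => energy v (Φ n)) atTop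
  refine le_iInf₂ fun Φ hΦ => ?_
  have heq : (fun n => energy v ((Φ n).constMul c hc)) = fun n => energy v (Φ n) :=
    funext fun n => TrialState.energy_constMul v c hc (Φ n)
  calc closedEnergy v L (fun X => c * Ψ X)
      ≤ liminf (fun n => energy v ((Φ n).constMul c hc)) atTop :=
        closedEnergy_le_liminf v (hΦ.constMul c hc)
    _ = liminf (fun n => energy v (Φ n)) atTop := by rw [heq]

/-! ### Ground states -/

/-- **`Ψ` is a ground state of `H_N` on `Λ_L^N` (Dirichlet, Bose sector).** `Ψ : (ℝ³)^N → ℂ` is a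
Borel measurable representative vanishing off the open box `Λ_L^N`, symmetric under permutations
of the particles, and a normalised MINIMISER of the closed Dirichlet quadratic form:
`q̄_{H_N}[Ψ] = E₀(N, L) = groundStateEnergy v N L < ⊤` (normalisation follows,
`IsGroundState.norm_eq`). Equivalently (min-max / variational principle, Reed–Simon IV Thm XIII.2)
`Ψ` is a normalised eigenvector of the Dirichlet realisation of `H_N` for the eigenvalue
`inf σ(H_N) = E₀`, which is Reed–Simon's definition of a ground state (§XIII.12, p. 201), here in
the Bose-symmetric sector as in LSSY §1.2. `N` is implicit in `Ψ`.
[cite: ReedSimonIV1978, §XIII.12 p. 201 and §XIII.1 Thm XIII.2] -/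
structure IsGroundState {N : ℕ} (v : ℝ → ℝ≥0∞) (L : ℝ) (Ψ : Config N → ℂ) : Prop where
  /-- `Ψ` is Borel measurable. -/
  measurable : Measurable Ψ
  /-- Dirichlet condition: `Ψ` vanishes off the open box `Λ_L^N`. -/
  eq_zero : ∀ X, X ∉ boxN N L → Ψ X = 0
  /-- Bose symmetry: `Ψ(x_{σ 1}, …, x_{σ N}) = Ψ(x₁, …, x_N)`. -/
  symm : ∀ (σ : Equiv.Perm (Fin N)) (X : Config N), Ψ (X ∘ σ) = Ψ X
  /-- Finite energy: `q̄[Ψ] < ∞`. -/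
  closedEnergy_ne_top : closedEnergy v L Ψ ≠ ⊤
  /-- Minimality: `q̄[Ψ] = E₀(N, L)`. -/
  closedEnergy_eq : closedEnergy v L Ψ = groundStateEnergy v N L

namespace IsGroundState

variable {N : ℕ} {v : ℝ → ℝ≥0∞} {L : ℝ} {Ψ : Config N → ℂ}

/-- A ground state is normalised: `∫ |Ψ|² = 1`. [cite: ReedSimonIV1978, §XIII.12 p. 201] -/
theorem norm_eq (h : IsGroundState v L Ψ) : ∫⁻ X, (‖Ψ X‖₊ : ℝ≥0∞) ^ 2 = 1 :=
  lintegral_nnnorm_sq_eq_one_of_closedEnergy_ne_top h.measurable.aestronglyMeasurable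
    h.closedEnergy_ne_top

/-- If a ground state exists, the ground-state energy is finite. [folklore] -/
theorem groundStateEnergy_ne_top (h : IsGroundState v L Ψ) : groundStateEnergy v N L ≠ ⊤ := by
  rw [← h.closedEnergy_eq]
  exact h.closedEnergy_ne_top

/-- A ground state minimises the closed energy: `q̄[Ψ] ≤ q̄[Φ]` for every `Φ`.
[cite: ReedSimonIV1978, §XIII.1 Thm XIII.2] -/
theorem closedEnergy_le (h : IsGroundState v L Ψ) (Φ : Config N → ℂ) :
    closedEnergy v L Ψ ≤ closedEnergy v L Φ :=
  h.closedEnergy_eq.trans_le (groundStateEnergy_le_closedEnergy v L Φ)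

/-- A ground state lies below every trial state: `q̄[Ψ] ≤ ⟨Φ, H_N Φ⟩`.
[cite: ReedSimonIV1978, §XIII.1 Thm XIII.2] -/
theorem closedEnergy_le_energy (h : IsGroundState v L Ψ) (Φ : TrialState N L) :
    closedEnergy v L Ψ ≤ energy v Φ :=
  (h.closedEnergy_le Φ.ψ).trans (BoseGas.closedEnergy_le_energy v Φ)

/-- A ground state is an `L²`-limit of trial states. [folklore] -/
theorem exists_tendstoL2 (h : IsGroundState v L Ψ) : ∃ Φ : ℕ → TrialState N L, TendstoL2 Φ Ψ :=
  exists_tendstoL2_of_closedEnergy_ne_top h.closedEnergy_ne_top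

/-- **How ground states are produced** (the entry point of the existence proof by compactness):
an admissible representative `Ψ` that is the `L²`-limit of a sequence of trial states whose
energies have `liminf ≤ E₀ < ⊤` (e.g. a convergent minimising sequence) is a ground state.
[cite: Kato1966, VI §1.3 Thm 1.16] -/
theorem of_tendstoL2 (hm : Measurable Ψ) (h0 : ∀ X, X ∉ boxN N L → Ψ X = 0)
    (hs : ∀ (σ : Equiv.Perm (Fin N)) (X : Config N), Ψ (X ∘ σ) = Ψ X)
    (hE : groundStateEnergy v N L ≠ ⊤) {Φ : ℕ → TrialState N L} (hΦ : TendstoL2 Φ Ψ)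
    (hlim : liminf (fun n => energy v (Φ n)) atTop ≤ groundStateEnergy v N L) :
    IsGroundState v L Ψ := by
  have heq : closedEnergy v L Ψ = groundStateEnergy v N L :=
    le_antisymm ((closedEnergy_le_liminf v hΦ).trans hlim)
      (groundStateEnergy_le_closedEnergy v L Ψ)
  exact ⟨hm, h0, hs, by rw [heq]; exact hE, heq⟩

/-- A constant phase times a ground state is a ground state. [folklore] -/
theorem const_mul (h : IsGroundState v L Ψ) {c : ℂ} (hc : ‖c‖ = 1) :
    IsGroundState v L (fun X => c * Ψ X) := by
  have heq : closedEnergy v L (fun X => c * Ψ X) = groundStateEnergy v N L :=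
    le_antisymm ((closedEnergy_const_mul_le v Ψ hc).trans_eq h.closedEnergy_eq)
      (groundStateEnergy_le_closedEnergy v L _)
  refine ⟨measurable_const.mul h.measurable, fun X hX => by simp [h.eq_zero X hX],
    fun σ X => by simp only [h.symm σ X], ?_, heq⟩
  rw [heq]
  exact h.groundStateEnergy_ne_top

end IsGroundState

/-- **The (nonnegative) ground state** `Ψ₀ = groundState v N L : (ℝ³)^N → ℝ` of `N` bosons in the
Dirichlet box `Λ_L` with pair profile `v`: a nonnegative real function whose complexification is a
ground state (`IsGroundState`), chosen by classical choice when one exists — the Perron–Frobenius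
choice of phase ("the (nonnegative and normalized) ground state", LSSY Ch. 7; strictly positive and
unique for `v` finite, Reed–Simon IV Thms XIII.46–47). **Junk value `0`** when no nonnegative ground
state exists (e.g. `N = 0`, `L ≤ 0`, or `E₀ = ⊤`). Existence (Rellich compactness) and uniqueness
(`HasUniqueGroundState`) are NOT asserted by this definition.
[cite: LSSY2005, §1.2 (1.17) and Ch. 7 (after (7.1))] -/
def groundState (v : ℝ → ℝ≥0∞) (N : ℕ) (L : ℝ) : Config N → ℝ :=
  open Classical in
  if h : ∃ Ψ₀ : Config N → ℝ, (∀ X, 0 ≤ Ψ₀ X) ∧ IsGroundState v L (fun X => (Ψ₀ X : ℂ))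
    then h.choose else 0

/-- `groundState ≥ 0` (in both branches). [folklore] -/
theorem groundState_nonneg (v : ℝ → ℝ≥0∞) (N : ℕ) (L : ℝ) (X : Config N) :
    0 ≤ groundState v N L X := by
  unfold groundState
  split_ifs with h
  · exact h.choose_spec.1 X
  · simp

/-- If a nonnegative ground state exists, `groundState` is one. [folklore] -/
theorem isGroundState_groundState {v : ℝ → ℝ≥0∞} {N : ℕ} {L : ℝ}
    (h : ∃ Ψ₀ : Config N → ℝ, (∀ X, 0 ≤ Ψ₀ X) ∧ IsGroundState v L (fun X => (Ψ₀ X : ℂ))) :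
    IsGroundState v L (fun X => (groundState v N L X : ℂ)) := by
  rw [groundState, dif_pos h]
  exact h.choose_spec.2

/-- Without a nonnegative ground state, `groundState` is the junk value `0`. [folklore] -/
theorem groundState_of_not_exists {v : ℝ → ℝ≥0∞} {N : ℕ} {L : ℝ}
    (h : ¬ ∃ Ψ₀ : Config N → ℝ, (∀ X, 0 ≤ Ψ₀ X) ∧ IsGroundState v L (fun X => (Ψ₀ X : ℂ))) :
    groundState v N L = 0 := by
  rw [groundState, dif_neg h]

/-- `groundState` is Borel measurable (in both branches). [folklore] -/
theorem measurable_groundState (v : ℝ → ℝ≥0∞) (N : ℕ) (L : ℝ) :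
    Measurable (groundState v N L) := by
  by_cases h : ∃ Ψ₀ : Config N → ℝ, (∀ X, 0 ≤ Ψ₀ X) ∧ IsGroundState v L (fun X => (Ψ₀ X : ℂ))
  · have hre := Complex.measurable_re.comp (isGroundState_groundState h).measurable
    have heq : (Complex.re ∘ fun X => ((groundState v N L X : ℝ) : ℂ)) = groundState v N L := by
      funext X
      simp
    rwa [heq] at hre
  · rw [groundState_of_not_exists h]
    exact measurable_const

/-- `groundState` vanishes off the open box (in both branches). [folklore] -/
theorem groundState_eq_zero_of_not_mem (v : ℝ → ℝ≥0∞) {N : ℕ} {L : ℝ} {X : Config N}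
    (hX : X ∉ boxN N L) : groundState v N L X = 0 := by
  by_cases h : ∃ Ψ₀ : Config N → ℝ, (∀ X, 0 ≤ Ψ₀ X) ∧ IsGroundState v L (fun X => (Ψ₀ X : ℂ))
  · have := (isGroundState_groundState h).eq_zero X hX
    exact_mod_cast this
  · simp [groundState_of_not_exists h]

/-- `groundState` is Bose symmetric (in both branches). [folklore] -/
theorem groundState_comp_perm (v : ℝ → ℝ≥0∞) {N : ℕ} (L : ℝ) (σ : Equiv.Perm (Fin N))
    (X : Config N) : groundState v N L (X ∘ σ) = groundState v N L X := by
  by_cases h : ∃ Ψ₀ : Config N → ℝ, (∀ X, 0 ≤ Ψ₀ X) ∧ IsGroundState v L (fun X => (Ψ₀ X : ℂ))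
  · have := (isGroundState_groundState h).symm σ X
    exact_mod_cast this
  · simp [groundState_of_not_exists h]

/-- When a nonnegative ground state exists, `groundState` is normalised: `∫ Ψ₀² = 1`.
[cite: LSSY2005, §1.2 (1.17)] -/
theorem lintegral_groundState_sq {v : ℝ → ℝ≥0∞} {N : ℕ} {L : ℝ}
    (h : ∃ Ψ₀ : Config N → ℝ, (∀ X, 0 ≤ Ψ₀ X) ∧ IsGroundState v L (fun X => (Ψ₀ X : ℂ))) :
    ∫⁻ X, ENNReal.ofReal (groundState v N L X) ^ 2 = 1 := by
  refine Eq.trans (lintegral_congr fun X => ?_) (isGroundState_groundState h).norm_eq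
  congr 1
  rw [Complex.nnnorm_real, ← enorm_eq_nnnorm, Real.enorm_eq_ofReal (groundState_nonneg v N L X)]

/-- **Nondegeneracy of the ground state.** A nonnegative ground state exists, and ground states
are unique up to a constant phase: any two agree a.e. after multiplication by some `c`, `|c| = 1`
(Reed–Simon IV §XIII.12: the ground-state eigenvalue is simple with a strictly positive
eigenfunction — proved there for `v` finite a.e. via positivity-improving `e^{-tH}`,
Thms XIII.44–XIII.47, and false in general for hard cores, Thm XIII.48(b); here a HYPOTHESIS).
[cite: ReedSimonIV1978, §XIII.12 Thms XIII.43–XIII.48] -/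
def HasUniqueGroundState (v : ℝ → ℝ≥0∞) (N : ℕ) (L : ℝ) : Prop :=
  (∃ Ψ₀ : Config N → ℝ, (∀ X, 0 ≤ Ψ₀ X) ∧ IsGroundState v L (fun X => (Ψ₀ X : ℂ))) ∧
    ∀ Ψ Φ : Config N → ℂ, IsGroundState v L Ψ → IsGroundState v L Φ →
      ∃ c : ℂ, ‖c‖ = 1 ∧ ∀ᵐ X : Config N, Φ X = c * Ψ X

namespace HasUniqueGroundState

variable {v : ℝ → ℝ≥0∞} {N : ℕ} {L : ℝ}

/-- Under nondegeneracy, `groundState` is a ground state.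
[cite: ReedSimonIV1978, §XIII.12 Thm XIII.47] -/
theorem isGroundState_groundState (h : HasUniqueGroundState v N L) :
    IsGroundState v L (fun X => (groundState v N L X : ℂ)) :=
  BoseGas.isGroundState_groundState h.1

/-- Under nondegeneracy every ground state is a.e. a constant phase times `groundState`.
[cite: ReedSimonIV1978, §XIII.12 Thm XIII.47] -/
theorem exists_ae_eq_groundState (h : HasUniqueGroundState v N L) {Φ : Config N → ℂ}
    (hΦ : IsGroundState v L Φ) :
    ∃ c : ℂ, ‖c‖ = 1 ∧ ∀ᵐ X : Config N, Φ X = c * (groundState v N L X : ℂ) :=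
  h.2 _ _ h.isGroundState_groundState hΦ

end HasUniqueGroundState

end Literature.MathematicalPhysics.QuantumManyBody.BoseGas

end
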